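import Summits.AtomisticToContinuum.BoseEinsteinCondensation.Theorems.PeriodicIRBound.Negative.FreeGas

/-!
# Negative lemmas for crux `PeriodicIRBound` (stmt-AtomisticToContinuum-3972), VI: normal forms and the sup-norm/Euclidean equivalence

Supports (does not close) stmt-AtomisticToContinuum-3972, route `BECGroundStateSOS`. Landed copy of
§14–§15 of `Cruxes/PeriodicIRBound/Disproof.lean` (cycle 2, gen-2 disprover seat); all `sorry`-free,
axioms `propext`/`Classical.choice`/`Quot.sound`.

* §14 `IRBoundWith.mono`, `irBoundWith_of_nonpos`, `irBoundFor_iff_all_kappa`, `irBoundFor_of_unbounded`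
  — the bound is antitone in `κ`, `ρ₀`, monotone in `C`; for `κ ≤ 0` the window is EMPTY (so the
  crux's `0 < κ` is idle) and any unbounded sequence of windows suffices.
* §15 `irBoundFor_iff₂` — the sup-norm reading (as typed: `‖·‖` on `Fin 3 → ℝ`) and the Euclidean
  reading (as glossed, `|k|₂ = √(nsq k)`) of window and shape are EQUIVALENT per potential, with
  constants `× √3` (`irBoundWith₂_of`, `irBoundWith_of₂`).
-/

noncomputable section

open MeasureTheory Filter
open scoped ENNReal NNReal ComplexConjugate BigOperators
namespace Summit.AtomisticToContinuum.BoseEinsteinCondensation.Theorems.PeriodicIRBound.Negative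

open Literature.MathematicalPhysics.QuantumManyBody.BoseGas
open Summit.AtomisticToContinuum.BoseEinsteinCondensation.Theses.BECGroundStateSOS
open Summit.AtomisticToContinuum.BoseEinsteinCondensation.Theorems.GaussianDominationCan.Negative
  (symState symFun oneBody periodicEnergy_symState nsq nsq_nonneg e0 e0_ne_zero norm_e0
    nsq_e0 one_le_norm_intVec isRepulsiveFiniteRange_zero)
open Summit.AtomisticToContinuum.BoseEinsteinCondensation.Theorems.CorrectorClosure.Negative
  (hardCore isRepulsiveFiniteRange_hardCore periodicEnergy_hardCore_eq_top
    periodicGroundStateEnergy_one_eq_top)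

variable {L : ℝ} {m : ℕ} {n : Fin 3 → ℤ} {a b : ℝ}

/-! ## §14 Normal forms: monotonicity in `κ`, `C`, `ρ₀`; the window for `κ ≤ 0` is empty -/

/-- `0 ≤ √ρ · L_N`. [folklore] -/
theorem sqrt_mul_sideLength_nonneg {ρ : ℝ} (hρ : 0 < ρ) (N : ℕ) :
    0 ≤ Real.sqrt ρ * sideLength ρ N :=
  mul_nonneg (Real.sqrt_nonneg _) (sideLength_nonneg hρ.le N)

/-- `IRIneq` is monotone in the constant. [folklore] -/
theorem IRIneq.mono {C C' ρ : ℝ} (hρ : 0 < ρ) {N : ℕ} {Ψ : Config N → ℂ} {k : Fin 3 → ℤ}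
    (h : IRIneq C ρ N Ψ k) (hCC' : C ≤ C') : IRIneq C' ρ N Ψ k := by
  refine h.trans (ENNReal.ofReal_le_ofReal (div_le_div_of_nonneg_right ?_ (norm_nonneg _)))
  have := sqrt_mul_sideLength_nonneg hρ N
  nlinarith

/-- `InWindow` is monotone in `κ`. [folklore] -/
theorem InWindow.mono {κ κ' ρ : ℝ} (hρ : 0 < ρ) {N : ℕ} {k : Fin 3 → ℤ} (h : InWindow κ' ρ N k)
    (hκ : κ' ≤ κ) : InWindow κ ρ N k :=
  ⟨h.1, h.2.trans (by
    have := sqrt_mul_sideLength_nonneg hρ N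
    nlinarith)⟩

/-- `IRBoundWith v κ ρ₀ C` is antitone in `κ`, antitone in `ρ₀` and monotone in `C`: smaller
windows, smaller density ranges and larger constants are weaker claims. [folklore] -/
theorem IRBoundWith.mono {v : ℝ → ℝ≥0∞} {κ κ' ρ₀ ρ₀' C C' : ℝ} (h : IRBoundWith v κ ρ₀ C)
    (hκ : κ' ≤ κ) (hρ₀ : ρ₀' ≤ ρ₀) (hC : C ≤ C') : IRBoundWith v κ' ρ₀' C' := by
  intro ρ hρ hρρ₀
  filter_upwards [h ρ hρ (hρρ₀.trans_le hρ₀)] with N ⟨δ, hδ, hN⟩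
  exact ⟨δ, hδ, fun Ψ hΨ k hk => (hN Ψ hΨ k (hk.mono hρ hκ)).mono hρ hC⟩

/-- **For `κ ≤ 0` the window is EMPTY** (`1 ≤ ‖k‖_∞` for `k ≠ 0` while `κ√ρ L_N ≤ 0`), so the
bound holds vacuously with any data: the hypothesis `0 < κ` of the crux is not load-bearing and
`PeriodicIRBound` is equivalent to its `∀ κ` form (`irBoundFor_iff_all_kappa`). [folklore] -/
theorem irBoundWith_of_nonpos {v : ℝ → ℝ≥0∞} {κ : ℝ} (hκ : κ ≤ 0) (ρ₀ C : ℝ) :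
    IRBoundWith v κ ρ₀ C := by
  intro ρ hρ _
  refine Eventually.of_forall fun N => ⟨1, one_pos, fun Ψ _ k hk => ?_⟩
  exfalso
  have h1 := one_le_norm_intVec hk.1
  have h2 : κ * Real.sqrt ρ * sideLength ρ N ≤ 0 := by
    have := sqrt_mul_sideLength_nonneg hρ N
    nlinarith
  linarith [hk.2]

/-- The crux per potential with `0 < κ` dropped. [folklore] -/
theorem irBoundFor_iff_all_kappa (v : ℝ → ℝ≥0∞) :
    IRBoundFor v ↔ ∀ κ : ℝ, ∃ ρ₀ : ℝ, 0 < ρ₀ ∧ ∃ C : ℝ, 0 < C ∧ IRBoundWith v κ ρ₀ C := by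
  refine ⟨fun h κ => ?_, fun h κ _ => h κ⟩
  rcases le_or_gt κ 0 with hκ | hκ
  · exact ⟨1, one_pos, 1, one_pos, irBoundWith_of_nonpos hκ 1 1⟩
  · exact h κ hκ

/-- **Large windows suffice**: by antitonicity in `κ` it is enough to prove the bound along ANY
unbounded set of window parameters (e.g. `κ = 1, 2, 3, …`). [folklore] -/
theorem irBoundFor_of_unbounded {v : ℝ → ℝ≥0∞}
    (h : ∀ κ₀ : ℝ, ∃ κ, κ₀ ≤ κ ∧ ∃ ρ₀ : ℝ, 0 < ρ₀ ∧ ∃ C : ℝ, 0 < C ∧ IRBoundWith v κ ρ₀ C) :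
    IRBoundFor v := by
  intro κ₀ _
  obtain ⟨κ, hκ, ρ₀, hρ₀, C, hC, h⟩ := h κ₀
  exact ⟨ρ₀, hρ₀, C, hC, h.mono hκ le_rfl le_rfl⟩

/-! ## §15 Sup norm versus Euclidean norm: the two readings of `‖k‖` are equivalent -/

/-- `‖k‖_∞ ≤ |k|₂ = √(nsq k)` on `ℤ³`. [folklore] -/
theorem norm_intVec_le_sqrt_nsq (k : Fin 3 → ℤ) : ‖(fun j => (k j : ℝ))‖ ≤ Real.sqrt (nsq k) := by
  refine (pi_norm_le_iff_of_nonneg (Real.sqrt_nonneg _)).2 fun j => ?_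
  rw [Real.norm_eq_abs, ← Real.sqrt_sq_eq_abs]
  exact Real.sqrt_le_sqrt
    (Finset.single_le_sum (fun i _ => sq_nonneg ((k i : ℝ))) (Finset.mem_univ j))

/-- `|k|₂ ≤ √3 ‖k‖_∞` on `ℤ³`. [folklore] -/
theorem sqrt_nsq_le_sqrt_three_mul_norm (k : Fin 3 → ℤ) :
    Real.sqrt (nsq k) ≤ Real.sqrt 3 * ‖(fun j => (k j : ℝ))‖ := by
  have hj : ∀ j, (k j : ℝ) ^ 2 ≤ ‖(fun j => (k j : ℝ))‖ ^ 2 := by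
    intro j
    have h1 : |(k j : ℝ)| ≤ ‖(fun j => (k j : ℝ))‖ := by
      have := norm_le_pi_norm (fun j => (k j : ℝ)) j
      rwa [Real.norm_eq_abs] at this
    nlinarith [abs_nonneg (k j : ℝ), sq_abs (k j : ℝ)]
  have hsum : nsq k ≤ 3 * ‖(fun j => (k j : ℝ))‖ ^ 2 := by
    unfold nsq
    rw [Fin.sum_univ_three]
    linarith [hj 0, hj 1, hj 2]
  calc Real.sqrt (nsq k) ≤ Real.sqrt (3 * ‖(fun j => (k j : ℝ))‖ ^ 2) := Real.sqrt_le_sqrt hsum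
    _ = Real.sqrt 3 * ‖(fun j => (k j : ℝ))‖ := by
        rw [Real.sqrt_mul (by norm_num), Real.sqrt_sq (norm_nonneg _)]

/-- `0 < |k|₂` for `k ≠ 0`. [folklore] -/
theorem sqrt_nsq_pos {k : Fin 3 → ℤ} (hk : k ≠ 0) : 0 < Real.sqrt (nsq k) :=
  lt_of_lt_of_le (lt_of_lt_of_le one_pos (one_le_norm_intVec hk)) (norm_intVec_le_sqrt_nsq k)

/-- The Euclidean window `k ≠ 0`, `|k|₂ ≤ κ√ρ L_N` (the docstring's reading of the crux). -/
def InWindow₂ (κ ρ : ℝ) (N : ℕ) (k : Fin 3 → ℤ) : Prop :=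
  k ≠ 0 ∧ Real.sqrt (nsq k) ≤ κ * Real.sqrt ρ * sideLength ρ N

/-- The Euclidean shape `n_k ≤ C√ρ L_N/|k|₂` (Bogoliubov's isotropic `1/|p|`). -/
def IRIneq₂ (C ρ : ℝ) (N : ℕ) (Ψ : Config N → ℂ) (k : Fin 3 → ℤ) : Prop :=
  cellOccupation N (sideLength ρ N)
      (fun x => ((Real.sqrt (sideLength ρ N ^ 3))⁻¹ : ℂ) * cellWave (sideLength ρ N) k x) Ψ ≤
    ENNReal.ofReal (C * Real.sqrt ρ * sideLength ρ N / Real.sqrt (nsq k))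

/-- The crux per potential in the EUCLIDEAN reading (window and shape through `|k|₂`). -/
def IRBoundWith₂ (v : ℝ → ℝ≥0∞) (κ ρ₀ C : ℝ) : Prop :=
  ∀ ρ : ℝ, 0 < ρ → ρ < ρ₀ → ∀ᶠ N : ℕ in atTop, ∃ δ : ℝ≥0∞, 0 < δ ∧
    ∀ Ψ : PeriodicTrialState N (sideLength ρ N), NearMin v ρ N δ Ψ →
      ∀ k : Fin 3 → ℤ, InWindow₂ κ ρ N k → IRIneq₂ C ρ N Ψ.ψ k

/-- Sup-norm form ⇒ Euclidean form, same window parameter, constant `× √3`. [folklore] -/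
theorem irBoundWith₂_of {v : ℝ → ℝ≥0∞} {κ ρ₀ C : ℝ} (hC : 0 ≤ C) (h : IRBoundWith v κ ρ₀ C) :
    IRBoundWith₂ v κ ρ₀ (Real.sqrt 3 * C) := by
  intro ρ hρ hρρ₀
  filter_upwards [h ρ hρ hρρ₀] with N ⟨δ, hδ, hN⟩
  refine ⟨δ, hδ, fun Ψ hΨ k hk => ?_⟩
  have hwin : InWindow κ ρ N k := ⟨hk.1, (norm_intVec_le_sqrt_nsq k).trans hk.2⟩
  have key := hN Ψ hΨ k hwin
  unfold IRIneq at key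
  refine key.trans (ENNReal.ofReal_le_ofReal ?_)
  have hn := lt_of_lt_of_le one_pos (one_le_norm_intVec hk.1)
  have hs := sqrt_nsq_pos hk.1
  have hB := sqrt_mul_sideLength_nonneg hρ N
  rw [div_le_div_iff₀ hn hs]
  have h3 := sqrt_nsq_le_sqrt_three_mul_norm k
  calc C * Real.sqrt ρ * sideLength ρ N * Real.sqrt (nsq k)
      ≤ C * Real.sqrt ρ * sideLength ρ N * (Real.sqrt 3 * ‖(fun j => (k j : ℝ))‖) := by
        apply mul_le_mul_of_nonneg_left h3
        have := mul_nonneg hC hB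
        linarith [mul_assoc C (Real.sqrt ρ) (sideLength ρ N)]
    _ = Real.sqrt 3 * C * Real.sqrt ρ * sideLength ρ N * ‖(fun j => (k j : ℝ))‖ := by ring

/-- Euclidean form with window `√3 κ` ⇒ sup-norm form with window `κ`, same constant. [folklore] -/
theorem irBoundWith_of₂ {v : ℝ → ℝ≥0∞} {κ ρ₀ C : ℝ} (hC : 0 ≤ C)
    (h : IRBoundWith₂ v (Real.sqrt 3 * κ) ρ₀ C) : IRBoundWith v κ ρ₀ C := by
  intro ρ hρ hρρ₀
  filter_upwards [h ρ hρ hρρ₀] with N ⟨δ, hδ, hN⟩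
  refine ⟨δ, hδ, fun Ψ hΨ k hk => ?_⟩
  have hB := sqrt_mul_sideLength_nonneg hρ N
  have hwin : InWindow₂ (Real.sqrt 3 * κ) ρ N k := by
    refine ⟨hk.1, (sqrt_nsq_le_sqrt_three_mul_norm k).trans ?_⟩
    calc Real.sqrt 3 * ‖(fun j => (k j : ℝ))‖ ≤ Real.sqrt 3 * (κ * Real.sqrt ρ * sideLength ρ N) :=
          mul_le_mul_of_nonneg_left hk.2 (Real.sqrt_nonneg _)
      _ = Real.sqrt 3 * κ * Real.sqrt ρ * sideLength ρ N := by ring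
  have key := hN Ψ hΨ k hwin
  unfold IRIneq₂ at key
  unfold IRIneq
  refine key.trans (ENNReal.ofReal_le_ofReal ?_)
  have hn := lt_of_lt_of_le one_pos (one_le_norm_intVec hk.1)
  exact div_le_div_of_nonneg_left (mul_nonneg (mul_nonneg hC (Real.sqrt_nonneg _))
    (sideLength_nonneg hρ.le N)) hn (norm_intVec_le_sqrt_nsq k)

/-- **The sup-norm and Euclidean readings of the crux are equivalent, potential by potential**
(constants change by `√3`): the retriage remark "‖k‖ on `Fin 3 → ℝ` is the sup norm while the
gloss says ‖k‖₂" is harmless, formally. [folklore] -/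
theorem irBoundFor_iff₂ (v : ℝ → ℝ≥0∞) :
    IRBoundFor v ↔ ∀ κ : ℝ, 0 < κ → ∃ ρ₀ : ℝ, 0 < ρ₀ ∧ ∃ C : ℝ, 0 < C ∧ IRBoundWith₂ v κ ρ₀ C := by
  constructor
  · intro h κ hκ
    obtain ⟨ρ₀, hρ₀, C, hC, h⟩ := h κ hκ
    exact ⟨ρ₀, hρ₀, Real.sqrt 3 * C, by positivity, irBoundWith₂_of hC.le h⟩
  · intro h κ hκ
    obtain ⟨ρ₀, hρ₀, C, hC, h⟩ := h (Real.sqrt 3 * κ) (by positivity)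
    exact ⟨ρ₀, hρ₀, C, hC, irBoundWith_of₂ hC.le h⟩

end Summit.AtomisticToContinuum.BoseEinsteinCondensation.Theorems.PeriodicIRBound.Negative

end
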